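import Mathlib
import Summits.Parity.BatemanHorn.Theorems.IsogenyRedeiTypeIMainTermEulerControl
import Summits.Parity.BatemanHorn.Theorems.IsogenyRedeiTypeIMainTermCounting
import Literature.NumberTheory.Sieve.PolynomialCongruencesLemmas
import Literature.NumberTheory.Sieve.BatemanHornLocalCounts

/-!
# Crux `PolyMobiusTail` (stmt-Parity-0870), line `Sketch`: stub `stub_tuple_rootCount_mean`

The tuple root-count mean value for a Bateman–Horn system `f : Fin k → ℤ[X]`:
`Σ_{d ∈ [1,⌊y⌋]^k, ∏ dᵢ ≤ y} μ²(d) · #{n < ∏ dᵢ : dᵢ ∣ fᵢ(n) ∀ i} ≤ C y (log y)^k` for `y ≥ 2`.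

Proof: the summand `c(d)` is multiplicative over tuples with coprime products (CRT for counts,
`card_filter_range_mul_of_periodic`), so its push-forward `H(m) = Σ_{∏ dᵢ = m} c(d)` is a
multiplicative arithmetic function (`isMultiplicative_pushforward`). Locally `H(p) = Σᵢ ρ_{fᵢ}(p)`,
`H(p^v) = 0` for `v > k`, `H(p^v) ≤ (v+1)^k p^v`, and `H(p^v) = 0` for `v ≥ 2` at every prime
`p > P₀` modulo which no two members have a common root (`exists_forall_not_dvd_eval_and_dvd_eval`).
The Euler-product majorant (`sum_le_prod_tsum_of_submultiplicative`) for `H(m)/m` and Mertens'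
bound for `ρ_{fᵢ}` (`exists_sum_primesLE_rootCount_div_le`) give `Σ_{m ≤ Y} H(m)/m ≪ (log Y)^k`,
and `Σ_{m ≤ Y} H(m) ≤ Y Σ_{m ≤ Y} H(m)/m`. [folklore]
-/

open scoped BigOperators ArithmeticFunction.Moebius
open Filter Finset Polynomial Asymptotics

namespace Summit.Parity.BatemanHorn.Theorems.PolyMobiusTail.NaturalForm

open Literature.NumberTheory.Sieve
open Summit.Parity.BatemanHorn.Theorems.TypeIMainTerm

/-! ### An abstract Euler-product majorant with finitely many bad primes -/

/-- **Euler-product majorant with local control.** Let `H ≥ 0` be a multiplicative arithmetic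
function with `H(p^v) = 0` for `v > K`, `H(p^v) ≤ (v+1)^K p^v`, and `H(p^v) = 0` for `v ≥ 2` at
the primes `p > P₀`. Then `Σ_{m ≤ Y} H(m)/m ≤ D^{P₀+1} · exp(Σ_{p ≤ Y} H(p)/p)` with
`D = Σ_{v ≤ K} (v+1)^K`. [folklore] -/
theorem sum_div_le_of_local_control (H : ArithmeticFunction ℝ) (hmul : H.IsMultiplicative)
    (h0 : ∀ n, 0 ≤ H n) {K P₀ : ℕ} (hvan : ∀ p, p.Prime → ∀ v, K < v → H (p ^ v) = 0)
    (hbd : ∀ p, p.Prime → ∀ v : ℕ, H (p ^ v) ≤ ((v : ℝ) + 1) ^ K * (p : ℝ) ^ v)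
    (hgood : ∀ p, p.Prime → P₀ < p → ∀ v, 2 ≤ v → H (p ^ v) = 0) (Y : ℕ) :
    ∑ m ∈ Icc 1 Y, H m / m ≤
      (∑ v ∈ range (K + 1), ((v : ℝ) + 1) ^ K) ^ (P₀ + 1) *
        Real.exp (∑ p ∈ Nat.primesLE Y, H p / p) := by
  set D : ℝ := ∑ v ∈ range (K + 1), ((v : ℝ) + 1) ^ K with hD
  have hD1 : 1 ≤ D := by
    have h := Finset.single_le_sum (f := fun v : ℕ => ((v : ℝ) + 1) ^ K) (fun v _ => by positivity)
      (Finset.mem_range.mpr (Nat.succ_pos K))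
    simpa using h
  have hD0 : 0 ≤ D := zero_le_one.trans hD1
  set h : ℕ → ℝ := fun n => H n / n with hh
  have hh0 : ∀ n, 0 ≤ h n := fun n => div_nonneg (h0 n) (Nat.cast_nonneg n)
  have hh1 : h 1 = 1 := by simp [hh, hmul.map_one]
  have hhz : h 0 ≤ 1 := by simp [hh]
  have hsub : ∀ m n, 1 < m → 1 < n → Nat.Coprime m n → h (m * n) ≤ h m * h n := by
    intro m n _ _ hmn
    simp only [hh]
    rw [hmul.map_mul_of_coprime hmn, Nat.cast_mul, mul_div_mul_comm]
  have hpv : ∀ p v : ℕ, h (p ^ v) = H (p ^ v) / (p : ℝ) ^ v := fun p v => by simp [hh]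
  have hzero : ∀ p, p.Prime → ∀ v ∉ range (K + 1), h (p ^ v) = 0 := by
    intro p hp v hv
    rw [Finset.mem_range, not_lt] at hv
    rw [hpv, hvan p hp v (by omega), zero_div]
  have hloc : ∀ p, p.Prime → Summable (fun v => h (p ^ v)) := fun p hp =>
    summable_of_ne_finset_zero (hzero p hp)
  refine (sum_le_prod_tsum_of_submultiplicative h hh0 hh1 hhz hsub hloc Y).trans ?_
  -- every local factor is at most `D`
  have hLD : ∀ p ∈ Nat.primesLE Y, ∑' v, h (p ^ v) ≤ D := by
    intro p hp
    have hp' := Nat.prime_of_mem_primesLE hp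
    rw [tsum_eq_sum (hzero p hp'), hD]
    refine Finset.sum_le_sum fun v _ => ?_
    have hp0 : (0 : ℝ) < (p : ℝ) ^ v := pow_pos (by exact_mod_cast hp'.pos) v
    rw [hpv, div_le_iff₀ hp0]
    exact hbd p hp' v
  -- at a good prime the local factor is `1 + H(p)/p`
  have hLgood : ∀ p ∈ Nat.primesLE Y, P₀ < p → ∑' v, h (p ^ v) = 1 + H p / p := by
    intro p hp hP
    have hp' := Nat.prime_of_mem_primesLE hp
    have hz2 : ∀ v ∉ range 2, h (p ^ v) = 0 := by
      intro v hv
      rw [Finset.mem_range, not_lt] at hv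
      rw [hpv, hgood p hp' hP v hv, zero_div]
    rw [tsum_eq_sum hz2, Finset.sum_range_succ, Finset.sum_range_one, pow_zero, hh1, pow_one]
  have hterm : ∀ p ∈ Nat.primesLE Y,
      ∑' v, h (p ^ v) ≤ (if p ≤ P₀ then D else 1) * Real.exp (H p / p) := by
    intro p hp
    have hexp : 1 ≤ Real.exp (H p / p) := Real.one_le_exp (div_nonneg (h0 p) (Nat.cast_nonneg p))
    split_ifs with hP
    · calc ∑' v, h (p ^ v) ≤ D * 1 := by rw [mul_one]; exact hLD p hp
        _ ≤ D * Real.exp (H p / p) := mul_le_mul_of_nonneg_left hexp hD0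
    · rw [hLgood p hp (not_le.mp hP), one_mul, add_comm]
      exact Real.add_one_le_exp _
  have hcard : ((Nat.primesLE Y).filter (fun p => p ≤ P₀)).card ≤ P₀ + 1 :=
    calc ((Nat.primesLE Y).filter (fun p => p ≤ P₀)).card ≤ (range (P₀ + 1)).card :=
          Finset.card_le_card fun p hp => by
            rw [Finset.mem_filter] at hp
            exact Finset.mem_range.mpr (Nat.lt_succ_of_le hp.2)
      _ = P₀ + 1 := Finset.card_range _
  calc ∏ p ∈ Nat.primesLE Y, ∑' v, h (p ^ v)
      ≤ ∏ p ∈ Nat.primesLE Y, ((if p ≤ P₀ then D else 1) * Real.exp (H p / p)) :=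
        Finset.prod_le_prod (fun p _ => tsum_nonneg fun v => hh0 _) hterm
    _ = D ^ ((Nat.primesLE Y).filter (fun p => p ≤ P₀)).card *
          Real.exp (∑ p ∈ Nat.primesLE Y, H p / p) := by
        rw [Finset.prod_mul_distrib, Real.exp_sum, Finset.prod_ite, Finset.prod_const,
          Finset.prod_const_one, mul_one]
    _ ≤ D ^ (P₀ + 1) * Real.exp (∑ p ∈ Nat.primesLE Y, H p / p) :=
        mul_le_mul_of_nonneg_right (pow_le_pow_right₀ hD1 hcard) (Real.exp_nonneg _)

/-! ### The tuple weight `c(d) = (∏ᵢ |μ(dᵢ)|) · #{n < ∏ dᵢ : dᵢ ∣ fᵢ(n) ∀ i}` -/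

variable {k : ℕ}

/-- `∏ᵢ |μ((d d')ᵢ)| = (∏ᵢ |μ(dᵢ)|)(∏ᵢ |μ(d'ᵢ)|)` for tuples with coprime products. [folklore] -/
theorem prod_abs_moebius_mul {d d' : Fin k → ℕ} (hcop : Nat.Coprime (∏ i, d i) (∏ i, d' i)) :
    ∏ i, |(μ ((d * d') i) : ℝ)| = (∏ i, |(μ (d i) : ℝ)|) * ∏ i, |(μ (d' i) : ℝ)| := by
  rw [← Finset.prod_mul_distrib]
  refine Finset.prod_congr rfl fun i _ => ?_
  have hci : Nat.Coprime (d i) (d' i) :=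
    Nat.Coprime.of_dvd (Finset.dvd_prod_of_mem d (Finset.mem_univ i))
      (Finset.dvd_prod_of_mem d' (Finset.mem_univ i)) hcop
  rw [Pi.mul_apply, ArithmeticFunction.isMultiplicative_moebius.map_mul_of_coprime hci,
    Int.cast_mul, abs_mul]

/-- The solution condition `dᵢ ∣ fᵢ(n) ∀ i` only depends on `n mod ∏ dᵢ`. [folklore] -/
theorem sysPred_mod_prod (f : Fin k → ℤ[X]) (d : Fin k → ℕ) (n : ℕ) :
    (∀ i, ((d i : ℕ) : ℤ) ∣ (f i).eval (n : ℤ)) ↔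
      ∀ i, ((d i : ℕ) : ℤ) ∣ (f i).eval ((n % ∏ i, d i : ℕ) : ℤ) :=
  sysPred_iff_of_modEq f d (fun i => Finset.dvd_prod_of_mem d (Finset.mem_univ i))
    (Nat.mod_modEq n _).symm

/-- **CRT for the counts over a full product period**: for tuples with coprime products,
`#{n < ∏(dd')ᵢ : (dd')ᵢ ∣ fᵢ(n)} = #{n < ∏ dᵢ : dᵢ ∣ fᵢ(n)} · #{n < ∏ d'ᵢ : d'ᵢ ∣ fᵢ(n)}`.
[folklore] -/
theorem card_sols_range_prod_mul (f : Fin k → ℤ[X]) {d d' : Fin k → ℕ}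
    (hcop : Nat.Coprime (∏ i, d i) (∏ i, d' i)) :
    ((Finset.range (∏ i, (d * d') i)).filter
        (fun n : ℕ => ∀ i, (((d * d') i : ℕ) : ℤ) ∣ (f i).eval (n : ℤ))).card =
      ((Finset.range (∏ i, d i)).filter
          (fun n : ℕ => ∀ i, ((d i : ℕ) : ℤ) ∣ (f i).eval (n : ℤ))).card *
        ((Finset.range (∏ i, d' i)).filter
          (fun n : ℕ => ∀ i, ((d' i : ℕ) : ℤ) ∣ (f i).eval (n : ℤ))).card := by
  have hprod : ∏ i, (d * d') i = (∏ i, d i) * ∏ i, d' i := by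
    simp only [Pi.mul_apply]
    exact Finset.prod_mul_distrib
  rw [← card_filter_range_mul_of_periodic hcop _ _ (sysPred_mod_prod f d) (sysPred_mod_prod f d'),
    hprod]
  congr 1
  exact Finset.filter_congr fun n _ => sysPred_mul_iff f hcop n

/-- **Tuple multiplicativity of the weight** `c(d) = (∏ᵢ |μ(dᵢ)|) · #{n < ∏ dᵢ : dᵢ ∣ fᵢ(n) ∀ i}`.
[folklore] -/
theorem weight_mul (f : Fin k → ℤ[X]) {d d' : Fin k → ℕ}
    (hcop : Nat.Coprime (∏ i, d i) (∏ i, d' i)) :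
    (∏ i, |(μ ((d * d') i) : ℝ)|) *
        ((((Finset.range (∏ i, (d * d') i)).filter
          (fun n : ℕ => ∀ i, (((d * d') i : ℕ) : ℤ) ∣ (f i).eval (n : ℤ))).card : ℕ) : ℝ) =
      (∏ i, |(μ (d i) : ℝ)|) *
          ((((Finset.range (∏ i, d i)).filter
            (fun n : ℕ => ∀ i, ((d i : ℕ) : ℤ) ∣ (f i).eval (n : ℤ))).card : ℕ) : ℝ) *
        ((∏ i, |(μ (d' i) : ℝ)|) *
          ((((Finset.range (∏ i, d' i)).filter
            (fun n : ℕ => ∀ i, ((d' i : ℕ) : ℤ) ∣ (f i).eval (n : ℤ))).card : ℕ) : ℝ)) := by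
  rw [prod_abs_moebius_mul hcop, card_sols_range_prod_mul f hcop, Nat.cast_mul]
  ring

/-- The weight is at most `∏ dᵢ`. [folklore] -/
theorem weight_le_prod (f : Fin k → ℤ[X]) (d : Fin k → ℕ) :
    (∏ i, |(μ (d i) : ℝ)|) *
        ((((Finset.range (∏ i, d i)).filter
          (fun n : ℕ => ∀ i, ((d i : ℕ) : ℤ) ∣ (f i).eval (n : ℤ))).card : ℕ) : ℝ) ≤
      ((∏ i, d i : ℕ) : ℝ) := by
  -- `|μ(n)| ≤ 1` in `ℝ` (cf. `ArithmeticFunction.abs_moebius_le_one` in `ℤ`)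
  have h1 : (∏ i, |(μ (d i) : ℝ)|) ≤ 1 :=
    Finset.prod_le_one (fun i _ => abs_nonneg _) fun i _ => by
      rw [← Int.cast_abs]
      exact_mod_cast ArithmeticFunction.abs_moebius_le_one
  have h2 : ((((Finset.range (∏ i, d i)).filter
      (fun n : ℕ => ∀ i, ((d i : ℕ) : ℤ) ∣ (f i).eval (n : ℤ))).card : ℕ) : ℝ) ≤
      ((∏ i, d i : ℕ) : ℝ) := by
    exact_mod_cast (Finset.card_filter_le _ _).trans (Finset.card_range _).le
  calc _ ≤ 1 * ((∏ i, d i : ℕ) : ℝ) := mul_le_mul h1 h2 (Nat.cast_nonneg _) zero_le_one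
    _ = _ := one_mul _

/-! ### Tuples with prime-power product -/

/-- If `∏ᵢ |μ(dᵢ)| ≠ 0` for a tuple of powers `dᵢ = p^{vᵢ}` then all `vᵢ ≤ 1`. [folklore] -/
theorem exp_le_one_of_prod_abs_moebius_ne_zero {p : ℕ} (hp : p.Prime) {d : Fin k → ℕ}
    {v : Fin k → ℕ} (hdv : ∀ i, d i = p ^ v i) (hne : (∏ i, |(μ (d i) : ℝ)|) ≠ 0) (i : Fin k) :
    v i ≤ 1 := by
  by_contra h
  refine hne (Finset.prod_eq_zero (Finset.mem_univ i) ?_)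
  rw [hdv i, ArithmeticFunction.moebius_apply_prime_pow hp (by omega), if_neg (by omega)]
  simp

/-- For `v > k` every tuple with product `p^v` has a coordinate `p^e`, `e ≥ 2`: `∏ᵢ |μ(dᵢ)| = 0`.
[folklore] -/
theorem prod_abs_moebius_eq_zero_of_lt {p : ℕ} (hp : p.Prime) {w : ℕ} (hw : k < w)
    {d : Fin k → ℕ} (hd : d ∈ Nat.finMulAntidiag k (p ^ w)) : (∏ i, |(μ (d i) : ℝ)|) = 0 := by
  obtain ⟨v, hdv, -, hsum⟩ := exists_pow_eq_of_mem_finMulAntidiag hp hd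
  by_contra hne
  have hle := exp_le_one_of_prod_abs_moebius_ne_zero hp hdv hne
  have : ∑ i, v i ≤ k :=
    calc ∑ i, v i ≤ ∑ _i : Fin k, 1 := Finset.sum_le_sum fun i _ => hle i
      _ = k := by simp
  omega

/-- At a prime `p` modulo which no two members have a common root, a square-free tuple with product
`p^w`, `w ≥ 2`, has no solutions at all. [folklore] -/
theorem filter_eq_empty_of_good (f : Fin k → ℤ[X]) {p : ℕ} (hp : p.Prime)
    (hgood : ∀ i j, i ≠ j → ∀ n : ℤ, ¬((p : ℤ) ∣ (f i).eval n ∧ (p : ℤ) ∣ (f j).eval n))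
    {w : ℕ} (hw : 2 ≤ w) {d : Fin k → ℕ} (hd : d ∈ Nat.finMulAntidiag k (p ^ w))
    (hne : (∏ i, |(μ (d i) : ℝ)|) ≠ 0) (s : Finset ℕ) :
    s.filter (fun n : ℕ => ∀ i, ((d i : ℕ) : ℤ) ∣ (f i).eval (n : ℤ)) = ∅ := by
  obtain ⟨v, hdv, -, hsum⟩ := exists_pow_eq_of_mem_finMulAntidiag hp hd
  have hle := exp_le_one_of_prod_abs_moebius_ne_zero hp hdv hne
  set T := Finset.univ.filter (fun i => v i = 1) with hT
  have hcardT : T.card = ∑ i, v i := by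
    rw [Finset.card_eq_sum_ones, Finset.sum_filter]
    refine Finset.sum_congr rfl fun i _ => ?_
    have := hle i
    interval_cases (v i) <;> simp
  obtain ⟨i, hi, i', hi', hii'⟩ := Finset.one_lt_card.mp (by omega : 1 < T.card)
  have hvi : v i = 1 := (Finset.mem_filter.mp hi).2
  have hvi' : v i' = 1 := (Finset.mem_filter.mp hi').2
  refine Finset.eq_empty_iff_forall_notMem.mpr fun n hn => ?_
  rw [Finset.mem_filter] at hn
  refine hgood i i' hii' n ⟨?_, ?_⟩
  · have := hn.2 i; rwa [hdv i, hvi, pow_one] at this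
  · have := hn.2 i'; rwa [hdv i', hvi', pow_one] at this

/-- **Tuples with prime product**: `Σ_{∏ dᵢ = p} c(d) = Σᵢ ρ_{fᵢ}(p)`. [folklore] -/
theorem sum_weight_prime (f : Fin k → ℤ[X]) {p : ℕ} (hp : p.Prime) :
    ∑ d ∈ Nat.finMulAntidiag k p, (∏ i, |(μ (d i) : ℝ)|) *
        ((((Finset.range (∏ i, d i)).filter
          (fun n : ℕ => ∀ i, ((d i : ℕ) : ℤ) ∣ (f i).eval (n : ℤ))).card : ℕ) : ℝ) =
      ∑ i, (polyRootCountMod ![f i] p : ℝ) := by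
  rw [sum_finMulAntidiag_prime hp]
  refine Finset.sum_congr rfl fun i _ => ?_
  have hprod : ∏ j, (Pi.mulSingle i p : Fin k → ℕ) j = p := by
    rw [Finset.prod_pi_mulSingle', if_pos (Finset.mem_univ i)]
  have hmu : ∏ j, |(μ ((Pi.mulSingle i p : Fin k → ℕ) j) : ℝ)| = 1 := by
    rw [Finset.prod_eq_single i (fun j _ hj => by rw [Pi.mulSingle_eq_of_ne hj]; simp)
      (fun h => absurd (Finset.mem_univ i) h), Pi.mulSingle_eq_same,
      ArithmeticFunction.moebius_apply_prime hp]
    simp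
  have hcount : ((Finset.range (∏ j, (Pi.mulSingle i p : Fin k → ℕ) j)).filter
      (fun n : ℕ => ∀ j, (((Pi.mulSingle i p : Fin k → ℕ) j : ℕ) : ℤ) ∣ (f j).eval (n : ℤ))).card =
      polyRootCountMod ![f i] p := by
    rw [← sysCount_mulSingle f p i, sysCount, tupleLcm_mulSingle, hprod]
    rfl
  rw [hmu, one_mul, hcount]

/-! ### The stub -/

/-- **Stub `stub_tuple_rootCount_mean`** (tuple root-count mean value). For a Bateman–Horn system
`f : Fin k → ℤ[X]` there is `C` with
`Σ_{d ∈ [1,⌊y⌋]^k, ∏ dᵢ ≤ y} (∏ᵢ |μ(dᵢ)|) · #{n < ∏ dᵢ : dᵢ ∣ fᵢ(n) ∀ i} ≤ C y (log y)^k` for all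
`y ≥ 2`. [folklore] -/
theorem stub_tuple_rootCount_mean : ∀ (k : ℕ) (f : Fin k → ℤ[X]),
    Literature.NumberTheory.Sieve.IsBatemanHornSystem f →
    ∃ C : ℝ, ∀ y : ℝ, 2 ≤ y →
      ∑ d ∈ Fintype.piFinset (fun _ : Fin k => Finset.Icc 1 ⌊y⌋₊),
        (if ∏ i, (d i : ℝ) ≤ y then
          (∏ i, |(ArithmeticFunction.moebius (d i) : ℝ)|) *
            (((Finset.range (∏ i, d i)).filter
                (fun n : ℕ => ∀ i, ((d i : ℕ) : ℤ) ∣ (f i).eval (n : ℤ))).card : ℝ)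
        else 0)
      ≤ C * y * Real.log y ^ k := by
  intro k f hf
  -- the weight and its push-forward
  set c : (Fin k → ℕ) → ℝ := fun d => (∏ i, |(μ (d i) : ℝ)|) *
    ((((Finset.range (∏ i, d i)).filter
      (fun n : ℕ => ∀ i, ((d i : ℕ) : ℤ) ∣ (f i).eval (n : ℤ))).card : ℕ) : ℝ) with hc
  have hc0 : ∀ d, 0 ≤ c d := fun d =>
    mul_nonneg (Finset.prod_nonneg fun i _ => abs_nonneg _) (Nat.cast_nonneg _)
  have hc1 : c (fun _ => 1) = 1 := by
    simp [hc]
  set H : ArithmeticFunction ℝ := ⟨fun m => ∑ d ∈ Nat.finMulAntidiag k m, c d, by simp⟩ with hH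
  have hHapply : ∀ m, H m = ∑ d ∈ Nat.finMulAntidiag k m, c d := fun m => rfl
  have hHmul : H.IsMultiplicative :=
    isMultiplicative_pushforward c hc1 fun d d' hcop => weight_mul f hcop
  have hH0 : ∀ n, 0 ≤ H n := fun n => Finset.sum_nonneg fun d _ => hc0 d
  -- local control
  obtain ⟨P₀, hP₀⟩ :=
    exists_forall_not_dvd_eval_and_dvd_eval hf.irreducible hf.pairwise_not_associated
  have hvan : ∀ p, p.Prime → ∀ v, k < v → H (p ^ v) = 0 := by
    intro p hp v hv
    rw [hHapply]
    refine Finset.sum_eq_zero fun d hd => ?_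
    simp only [hc]
    rw [prod_abs_moebius_eq_zero_of_lt hp hv hd, zero_mul]
  have hbd : ∀ p, p.Prime → ∀ v : ℕ, H (p ^ v) ≤ ((v : ℝ) + 1) ^ k * (p : ℝ) ^ v := by
    intro p hp v
    rw [hHapply]
    calc ∑ d ∈ Nat.finMulAntidiag k (p ^ v), c d
        ≤ ∑ d ∈ Nat.finMulAntidiag k (p ^ v), ((p : ℝ) ^ v) := by
          refine Finset.sum_le_sum fun d hd => ?_
          calc c d ≤ ((∏ i, d i : ℕ) : ℝ) := weight_le_prod f d
            _ = (p : ℝ) ^ v := by rw [Nat.prod_eq_of_mem_finMulAntidiag hd, Nat.cast_pow]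
      _ = ((Nat.finMulAntidiag k (p ^ v)).card : ℝ) * (p : ℝ) ^ v := by
          rw [Finset.sum_const, nsmul_eq_mul]
      _ ≤ ((v : ℝ) + 1) ^ k * (p : ℝ) ^ v := by
          gcongr
          exact_mod_cast card_finMulAntidiag_prime_pow_le hp v
  have hgood : ∀ p, p.Prime → P₀ < p → ∀ v, 2 ≤ v → H (p ^ v) = 0 := by
    intro p hp hP v hv
    rw [hHapply]
    refine Finset.sum_eq_zero fun d hd => ?_
    simp only [hc]
    by_cases hne : (∏ i, |(μ (d i) : ℝ)|) = 0
    · rw [hne, zero_mul]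
    · rw [filter_eq_empty_of_good f hp (hP₀ p hP) hv hd hne, Finset.card_empty, Nat.cast_zero,
        mul_zero]
  have hHp : ∀ p, p.Prime → H p = ∑ i, (polyRootCountMod ![f i] p : ℝ) := by
    intro p hp
    rw [hHapply]
    exact sum_weight_prime f hp
  -- Mertens constants
  have hM : ∀ i, ∃ Ci : ℝ, ∀ x : ℕ, 2 ≤ x →
      ∑ p ∈ Nat.primesLE x, (polyRootCountMod ![f i] p : ℝ) / p ≤ Real.log (Real.log x) + Ci :=
    fun i => exists_sum_primesLE_rootCount_div_le (hf.irreducible i) (natDegree_member_pos f hf i)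
  choose Cm hCm using hM
  set D : ℝ := ∑ v ∈ range (k + 1), ((v : ℝ) + 1) ^ k with hD
  have hD0 : 0 ≤ D := Finset.sum_nonneg fun v _ => by positivity
  refine ⟨D ^ (P₀ + 1) * Real.exp (∑ i, Cm i), fun y hy => ?_⟩
  set Y := ⌊y⌋₊ with hY
  have hy0 : 0 ≤ y := by linarith
  have hY2 : 2 ≤ Y := Nat.le_floor (by exact_mod_cast hy)
  have hYy : (Y : ℝ) ≤ y := Nat.floor_le hy0
  have hY0 : (0 : ℝ) < Y := by exact_mod_cast (by omega : 0 < Y)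
  have hlogY : 0 < Real.log Y := Real.log_pos (by exact_mod_cast (by omega : 1 < Y))
  have hlog_le : Real.log Y ≤ Real.log y := Real.log_le_log hY0 hYy
  -- Step 1: regroup by the value of the product
  rw [← Finset.sum_filter, sum_box_filter_eq_sum_Ioc c hy0]
  -- Step 2: `Σ_{m ≤ Y} H(m) ≤ Y Σ_{m ≤ Y} H(m)/m`
  have hstep : ∑ m ∈ Ioc 0 Y, ∑ d ∈ Nat.finMulAntidiag k m, c d ≤
      (Y : ℝ) * ∑ m ∈ Icc 1 Y, H m / m := by
    rw [← show Finset.Icc 1 Y = Finset.Ioc 0 Y from Finset.Icc_succ_left_eq_Ioc _ _,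
      Finset.mul_sum]
    refine Finset.sum_le_sum fun m hm => ?_
    rw [Finset.mem_Icc] at hm
    have hm0 : (0 : ℝ) < m := by exact_mod_cast hm.1
    have hmY : (m : ℝ) ≤ Y := by exact_mod_cast hm.2
    rw [← hHapply]
    calc H m = m * (H m / m) := by field_simp
      _ ≤ Y * (H m / m) := mul_le_mul_of_nonneg_right hmY (div_nonneg (hH0 m) hm0.le)
  -- Step 3: Euler majorant and Mertens
  have heuler := sum_div_le_of_local_control H hHmul hH0 hvan hbd hgood Y
  have hmert : ∑ p ∈ Nat.primesLE Y, H p / p ≤ ∑ i, (Real.log (Real.log Y) + Cm i) :=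
    calc ∑ p ∈ Nat.primesLE Y, H p / p
        = ∑ p ∈ Nat.primesLE Y, ∑ i, (polyRootCountMod ![f i] p : ℝ) / p := by
          refine Finset.sum_congr rfl fun p hp => ?_
          rw [hHp p (Nat.prime_of_mem_primesLE hp), Finset.sum_div]
      _ = ∑ i, ∑ p ∈ Nat.primesLE Y, (polyRootCountMod ![f i] p : ℝ) / p := Finset.sum_comm
      _ ≤ ∑ i, (Real.log (Real.log Y) + Cm i) := Finset.sum_le_sum fun i _ => hCm i Y hY2
  have hexp : Real.exp (∑ p ∈ Nat.primesLE Y, H p / p) ≤ Real.log Y ^ k * Real.exp (∑ i, Cm i) :=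
    calc Real.exp (∑ p ∈ Nat.primesLE Y, H p / p)
        ≤ Real.exp (∑ i, (Real.log (Real.log Y) + Cm i)) := Real.exp_le_exp.mpr hmert
      _ = Real.log Y ^ k * Real.exp (∑ i, Cm i) := by
          rw [Finset.sum_add_distrib, Finset.sum_const, Finset.card_univ, Fintype.card_fin,
            nsmul_eq_mul, Real.exp_add, Real.exp_nat_mul, Real.exp_log hlogY]
  -- assembly
  calc ∑ m ∈ Ioc 0 Y, ∑ d ∈ Nat.finMulAntidiag k m, c d
      ≤ (Y : ℝ) * ∑ m ∈ Icc 1 Y, H m / m := hstep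
    _ ≤ (Y : ℝ) * (D ^ (P₀ + 1) * Real.exp (∑ p ∈ Nat.primesLE Y, H p / p)) :=
        mul_le_mul_of_nonneg_left heuler (Nat.cast_nonneg Y)
    _ ≤ (Y : ℝ) * (D ^ (P₀ + 1) * (Real.log Y ^ k * Real.exp (∑ i, Cm i))) :=
        mul_le_mul_of_nonneg_left (mul_le_mul_of_nonneg_left hexp (pow_nonneg hD0 _))
          (Nat.cast_nonneg Y)
    _ ≤ y * (D ^ (P₀ + 1) * (Real.log y ^ k * Real.exp (∑ i, Cm i))) := by
        have h1 : Real.log Y ^ k ≤ Real.log y ^ k := pow_le_pow_left₀ hlogY.le hlog_le k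
        have h2 : 0 ≤ D ^ (P₀ + 1) * (Real.log y ^ k * Real.exp (∑ i, Cm i)) :=
          mul_nonneg (pow_nonneg hD0 _)
            (mul_nonneg (pow_nonneg (hlogY.le.trans hlog_le) _) (Real.exp_nonneg _))
        calc (Y : ℝ) * (D ^ (P₀ + 1) * (Real.log Y ^ k * Real.exp (∑ i, Cm i)))
            ≤ (Y : ℝ) * (D ^ (P₀ + 1) * (Real.log y ^ k * Real.exp (∑ i, Cm i))) :=
              mul_le_mul_of_nonneg_left (mul_le_mul_of_nonneg_left
                (mul_le_mul_of_nonneg_right h1 (Real.exp_nonneg _)) (pow_nonneg hD0 _))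
                (Nat.cast_nonneg Y)
          _ ≤ y * (D ^ (P₀ + 1) * (Real.log y ^ k * Real.exp (∑ i, Cm i))) :=
              mul_le_mul_of_nonneg_right hYy h2
    _ = D ^ (P₀ + 1) * Real.exp (∑ i, Cm i) * y * Real.log y ^ k := by ring

end Summit.Parity.BatemanHorn.Theorems.PolyMobiusTail.NaturalForm
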